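import Literature.Computability.Complexity.FinitePatchMachines
import Literature.Computability.Complexity.StackUnaryBits
import Literature.Computability.Complexity.NTIMEMono
import HarnessLib

/-!
# Linear functions are time constructible (a linear-time unary-to-binary counter)

Literature / complexity toolkit, first brick of the inline formalization of the shell of
Paul–Pippenger–Szemerédi–Trotter 1983 (`PaulPippengerSzemerediTrotter1983.lean`, fact
`PaulEtAl1983_NTIME_not_subset_DTIME`): the final contradiction of that proof is with a TIME
HIERARCHY theorem between the linear level and a slightly superlinear one (PPST 1983, §4;
Santhanam 2001, §2: "a collapse lemma and a hierarchy theorem"), and the tree's hierarchy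
theorem (`Diag.ntime_hierarchy_holds`, Žák's form) asks both bounds to be time constructible in
the sense of `IsTimeConstructible` (`Classes.lean`: `t n ≥ n` and `1ⁿ ↦ bin (t n)` within
`O(t n)` steps). The tree proves this for superpolynomial bounds only (`LogGrowthClocks.lean`,
`NSubexp.lean`: there the polynomial cost of the `FP` numeral bricks is absorbed), not for the
identity, whose clock must be genuinely linear. This file supplies it:

* `LinClock.prog` — a structured stack program (`Com`, `StackPrograms.lean`) converting the unary
  input `1ⁿ` into Mathlib's little-endian numeral `encodeNat n` by repeated halving with parity
  (`Com.halvePar`, `StackUnaryBits.lean`), the value being halved IN PLACE so that the total cost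
  is geometric: **`LinClock.runs_prog`**, cost `≤ 27 n + 2`;
* **`timeComputable_unary_id`**: `1ⁿ ↦ bin n` is `TimeComputable unaryEncodeNat encodeNat` in
  time `28 n + 28`; **`isTimeConstructible_id : IsTimeConstructible (fun n => n)`**;
  **`isTimeConstructible_linear`**: `n ↦ c n + c` (`1 ≤ c`) is time constructible
  (`IsTimeConstructible.mul_add`, `NTIMEMono.lean`);
* **`exists_linear_unaryClock`**: the unary clocks `x ↦ ⟨x, 1^{c|x|+c}⟩` in time `O(|x|)`
  (`exists_unaryClock_of_timeConstructible`, `NTIMEHierarchyClock.lean`), along which linear-time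
  verifiers are cut and transported (`NVerifier.exists_transport`, `truncMapAux`).

Arora–Barak 2009, §1.3 (p. 16): "the function `T(n) = n` … [is] time constructible"; the
conversion unary→binary in linear time by halving is folklore (Knuth, TAOCP 2, §4.4).

## References

* S. Arora, B. Barak, *Computational Complexity: A Modern Approach*, CUP 2009, §1.3
  (time-constructible functions, examples `n`, `n log n`, `n²`, `2ⁿ`) [AroraBarakCC2009].
* W. J. Paul, N. Pippenger, E. Szemerédi, W. T. Trotter, *On determinism versus non-determinism
  and related problems*, FOCS 1983, 429–438, §4 [PaulEtAl1983].
* D. E. Knuth, *The Art of Computer Programming*, Vol. 2, 3rd ed., §4.4 (radix conversion).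
-/

namespace Literature.Computability.Complexity

open _root_.Computability Turing

/-! ### The little-endian numeral, digit by digit -/

/-- **Mathlib's numeral peels off its least significant digit**: for `n ≠ 0`,
`encodeNat n = [n odd] :: encodeNat (n / 2)` (both sides are canonical numerals — no trailing
`false` — of the same value). [folklore] -/
theorem encodeNat_eq_cons_div_two {n : ℕ} (hn : n ≠ 0) :
    encodeNat n = decide (n % 2 = 1) :: encodeNat (n / 2) := by
  refine eq_of_bitsToNat_eq_of_canonical _ _ (encodeNat_canonical n) ?_ ?_
  · rcases encodeNat_canonical (n / 2) with h | ⟨v, hv⟩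
    · have h2 : n / 2 = 0 := by simpa using congrArg bitsToNat h
      have h1 : n % 2 = 1 := by omega
      exact Or.inr ⟨[], by simp [h, h1]⟩
    · exact Or.inr ⟨decide (n % 2 = 1) :: v, by simp [hv]⟩
  · simp only [bitsToNat_encodeNat, bitsToNat_cons]
    rcases Nat.mod_two_eq_zero_or_one n with h | h <;> simp [h] <;> omega

/-- `|encodeNat n| ≤ n` (a private copy of `StackNumeric.lean`'s lemma, to keep the imports of
this brick small). [folklore] -/
private theorem length_encodeNat_le_self_aux (n : ℕ) : (encodeNat n).length ≤ n := by
  induction n using Nat.strong_induction_on with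
  | _ n ih =>
    rcases Nat.eq_zero_or_pos n with rfl | hn
    · simp [encodeNat, encodeNum]
    · rw [encodeNat_eq_cons_div_two hn.ne', List.length_cons]
      have := ih (n / 2) (Nat.div_lt_self hn one_lt_two)
      omega

/-! ### The counter program -/

namespace LinClock

open Com AReg

/-- One halving round, entered after the loop has popped one unit of the value register `x`
(so `x = 1ʳ` with `r = I - 1` for the current value `I ≥ 1`): halve `r` with parity into the
empty scratch `s` and flag `f`; if `r` is odd (`I` even) the digit is `0` and `I / 2 = r / 2 + 1`,
if `r` is even (`I` odd) the digit is `1` and `I / 2 = r / 2`; push the digit on `t` and move the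
new value back to `x`. [folklore] -/
def body : Com AReg :=
  halvePar .x .s .f ;;
  pop .f (push .s true ;; push .t false) (push .s true ;; push .t false) (push .t true) ;;
  pour .s .x

/-- The halving loop: digits of the value of `x`, least significant first, pushed on `t`.
[folklore] -/
def binLoop : Com AReg := loop .x body body

/-- The counter program: halving loop, then pour the digits (reversing them back to
little-endian order) onto the output register `y`. [folklore] -/
def prog : Com AReg := binLoop ;; pour .t .y

/-- **Effect of one round** from `x = 1ʳ`, `s = f = ε`, digits `o` on `t` (cost `≤ 7 r + 10`):
`x := 1^{(r+1)/2}`, `t := [(r+1) odd] :: o`. [folklore] -/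
theorem runs_body (r : ℕ) (o yv zv uv gv : List Bool) :
    Runs body (file (List.replicate r true) yv zv [] o uv [] gv)
      (file (List.replicate ((r + 1) / 2) true) yv zv [] (decide ((r + 1) % 2 = 1) :: o) uv [] gv)
      (7 * r + 10) := by
  have h1 := runs_halvePar (v := AReg.x) (a := AReg.s) (par := AReg.f) (by decide) (by decide)
    (by decide) r (file (List.replicate r true) yv zv [] o uv [] gv) (by simp)
  simp only [file_s, file_f, List.append_nil, update_file_x, update_file_s, update_file_f] at h1
  rcases Nat.mod_two_eq_zero_or_one r with hr | hr
  · -- `r` even: `I = r + 1` odd, digit `1`, new value `r / 2`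
    have h2 : Runs (pop AReg.f (push .s true ;; push .t false) (push .s true ;; push .t false)
        (push .t true))
        (file [] yv zv (List.replicate (r / 2) true) o uv (List.replicate (r % 2) true) gv)
        (file [] yv zv (List.replicate (r / 2) true) (true :: o) uv [] gv) 3 := by
      rw [hr]
      exact Runs.pop_nil _ _ (by simp) ((Runs.push AReg.t true _).of_eq (by simp) le_rfl)
    have h3 := runs_pour (a := AReg.s) (b := AReg.x) (by decide)
      (file [] yv zv (List.replicate (r / 2) true) (true :: o) uv [] gv)
    simp only [file_s, file_x, List.reverse_replicate, List.append_nil, List.length_replicate,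
      update_file_s, update_file_x] at h3
    refine (h1.seq (h2.seq h3)).of_eq ?_ ?_
    · have e1 : (r + 1) / 2 = r / 2 := by omega
      have e2 : (r + 1) % 2 = 1 := by omega
      simp [e1, e2]
    · omega
  · -- `r` odd: `I = r + 1` even, digit `0`, new value `r / 2 + 1`
    have h2 : Runs (pop AReg.f (push .s true ;; push .t false) (push .s true ;; push .t false)
        (push .t true))
        (file [] yv zv (List.replicate (r / 2) true) o uv (List.replicate (r % 2) true) gv)
        (file [] yv zv (List.replicate (r / 2 + 1) true) (false :: o) uv [] gv) 4 := by
      rw [hr]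
      refine Runs.pop_true _ _ (w := []) (by simp [List.replicate_succ]) ?_
      refine ((Runs.push AReg.s true _).seq (Runs.push AReg.t false _)).of_eq ?_ le_rfl
      simp [List.replicate_succ]
    have h3 := runs_pour (a := AReg.s) (b := AReg.x) (by decide)
      (file [] yv zv (List.replicate (r / 2 + 1) true) (false :: o) uv [] gv)
    simp only [file_s, file_x, List.reverse_replicate, List.append_nil, List.length_replicate,
      update_file_s, update_file_x] at h3
    refine (h1.seq (h2.seq h3)).of_eq ?_ ?_
    · have e1 : (r + 1) / 2 = r / 2 + 1 := by omega
      have e2 : (r + 1) % 2 = 0 := by omega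
      simp [e1, e2]
    · omega

/-- **Effect of the halving loop** from `x = 1ᴵ`, `s = f = ε` (cost `≤ 24 I + 1`): `x` emptied,
the numeral `encodeNat I` pushed REVERSED on `t` (most significant digit on top). [folklore] -/
theorem runs_binLoop : ∀ (I : ℕ) (o yv zv uv gv : List Bool),
    Runs binLoop (file (List.replicate I true) yv zv [] o uv [] gv)
      (file [] yv zv [] ((encodeNat I).reverse ++ o) uv [] gv) (24 * I + 1)
  | 0, o, yv, zv, uv, gv =>
    (Runs.loop_nil _ _ (by simp)).of_eq (by simp [encodeNat, encodeNum]) (by simp)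
  | I + 1, o, yv, zv, uv, gv => by
    have hbody := runs_body I o yv zv uv gv
    have ih := runs_binLoop ((I + 1) / 2) (decide ((I + 1) % 2 = 1) :: o) yv zv uv gv
    refine (Runs.loop_true (w := List.replicate I true) (by simp [List.replicate_succ])
      (by simpa using hbody) ih).of_eq ?_ ?_
    · rw [encodeNat_eq_cons_div_two (Nat.succ_ne_zero I)]
      simp
    · omega

/-- **The counter**: from `1ⁿ` on `x` (all else empty) to `encodeNat n` on `y` (all else empty)
within `27 n + 2` steps. [cite: AroraBarakCC2009, §1.3 (p. 16: `T(n) = n` is time constructible)] -/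
theorem runs_prog (n : ℕ) :
    Runs prog (file (List.replicate n true) [] [] [] [] [] [] [])
      (file [] (encodeNat n) [] [] [] [] [] []) (27 * n + 2) := by
  have h1 := runs_binLoop n [] [] [] [] []
  simp only [List.append_nil] at h1
  have h2 := runs_pour (a := AReg.t) (b := AReg.y) (by decide)
    (file [] [] [] [] (encodeNat n).reverse [] [] [])
  simp only [file_t, file_y, List.append_nil, List.reverse_reverse, List.length_reverse,
    update_file_t, update_file_y] at h2
  have hl := length_encodeNat_le_self_aux n
  refine (h1.seq h2).of_eq ?_ ?_
  · rfl
  · omega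

/-- **The compiled counter machine**: `1ⁿ ↦ encodeNat n` within `27 n + 3` steps on Mathlib's
`TM2` (`Com.outputsWithin_of_runs_equiv`; register bank lemmas `Com.init_x_eq_file`,
`Com.init_y_eq_file` of `FinitePatchMachines.lean`). [cite: AroraBarakCC2009, §1.3 (p. 16)] -/
theorem exists_outputsWithin_unary_to_binary :
    ∃ M : TM2ComputableAux Bool Bool, ∀ n : ℕ,
      M.OutputsWithin (List.replicate n true) (encodeNat n) (27 * n + 3) := by
  refine ⟨(compile (prog.map (Fintype.equivFin AReg))).toAux (Fintype.equivFin AReg .x)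
    (Fintype.equivFin AReg .y), fun n => ?_⟩
  have h := runs_prog n
  rw [← Com.init_x_eq_file, ← Com.init_y_eq_file] at h
  exact Com.outputsWithin_of_runs_equiv (Fintype.equivFin AReg) (Or.inl h)

end LinClock

/-! ### Time constructibility of linear bounds -/

/-- **`1ⁿ ↦ bin n` in linear time**: the identity is `TimeComputable unaryEncodeNat encodeNat` within
`28 n + 28` steps. [cite: AroraBarakCC2009, §1.3 (p. 16)] -/
theorem timeComputable_unary_id :
    TimeComputable unaryEncodeNat encodeNat (fun n : ℕ => n) (fun n => 28 * n + 28) := by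
  obtain ⟨M, hM⟩ := LinClock.exists_outputsWithin_unary_to_binary
  refine ⟨M, fun n => ?_⟩
  have hl : (unaryEncodeNat n).length = n := unary_decode_encode_nat n
  dsimp only
  rw [hl, unaryEncodeNat_eq_replicate]
  exact (hM n).mono (by omega)

/-- **The identity is time constructible** (Arora–Barak 2009, §1.3: "`T(n) = n` … time
constructible"), in the tree's sense `IsTimeConstructible` (`Classes.lean`).
[cite: AroraBarakCC2009, §1.3 (p. 16)] -/
theorem isTimeConstructible_id : IsTimeConstructible (fun n : ℕ => n) :=
  ⟨fun _ => le_rfl, 28, timeComputable_unary_id⟩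

/-- **Linear bounds `n ↦ c n + c` (`1 ≤ c`) are time constructible**
(`IsTimeConstructible.mul_add`). [cite: AroraBarakCC2009, §1.3 (p. 16)] -/
theorem isTimeConstructible_linear {c : ℕ} (hc : 1 ≤ c) :
    IsTimeConstructible (fun n : ℕ => c * n + c) :=
  isTimeConstructible_id.mul_add hc

/-- **Linear unary clocks**: for every `c` some `TM2` machine maps every `x` to `⟨x, 1^{c|x|+c}⟩`
within `a (c|x| + c) + a` steps (`exists_unaryClock_of_timeConstructible`). These are the clocks
along which linear-time verifiers cut over-long witnesses (`truncMapAux`, `NVerifier.exists_transport`).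
[cite: AroraBarakCC2009, §1.3 and Thm. 2.6] -/
theorem exists_linear_unaryClock {c : ℕ} (hc : 1 ≤ c) :
    ∃ (N : TM2ComputableAux Bool Bool) (a : ℕ), ∀ x : List Bool,
      N.OutputsWithin x (boolPair x (List.replicate (c * x.length + c) true))
        (a * (c * x.length + c) + a) :=
  exists_unaryClock_of_timeConstructible (isTimeConstructible_linear hc)

end Literature.Computability.Complexity
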